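import Summits.HubbardSuperconductivity.HubbardLadder.ClusterCutOct12Adv33It7Frame09Qa
import Summits.HubbardSuperconductivity.HubbardLadder.ClusterCutOct12Adv33It7Frame09Qb
import Summits.HubbardSuperconductivity.HubbardLadder.ClusterCutOct12Adv33It7Frame09L
import Summits.HubbardSuperconductivity.HubbardLadder.PsdCertFactor
import HarnessLib

/-!
# Kernel frame certificate, piece 9: the PSD kernel facts (supplied-factor shape + residual bands)

HONEST FRAMING: ladder R1–R4 with certified numbers; no claim on H/H₀.  Cell pub-hubbard, lane r2-eng-1 (g14; g13 generators `adv06cert-g13/gen/`).  Split off the certificate module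
`ClusterCutOct12Adv33It7Frame09` (which imports this file and derives `Q ⪰ 0` inside `adv33it7Frame09`) so that no module's kernel time approaches the
gate's 600-s elaboration wall: here `adv33it7Shape09` (`psdShape`) and the `ddBand` facts `adv33it7DD09_k` on the literal block `adv33it7Q09` (assembled here as `adv33it7Q09a ++ adv33it7Q09b`), all by `decide +kernel`.  All statements [folklore].
-/

namespace Summit.HubbardSuperconductivity.HubbardLadder.ClusterCut

open Summit.HubbardSuperconductivity.HubbardLadder.PsdCert

/-- The literal block `Q = 65536·(B + 876144·G)` of piece 9 (121 × 121), assembled from its two row blocks. -/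
noncomputable def adv33it7Q09 : List (List ℤ) := adv33it7Q09a ++ adv33it7Q09b

set_option maxRecDepth 16384 in
set_option maxHeartbeats 4000000 in
/-- Kernel: shape facts of the supplied-factor certificate. -/
theorem adv33it7Shape09 : psdShape 121 1099511627776 adv33it7D09 adv33it7L09 adv33it7Q09 = true := by
  decide +kernel

set_option maxRecDepth 16384 in
set_option maxHeartbeats 4000000 in
/-- Kernel residual band 0: rows [0, 71) of `s²Q − L̂D̂L̂ᵀ` are diagonally dominant. -/
theorem adv33it7DD09_0 : ddBand 1099511627776 adv33it7D09 adv33it7L09 adv33it7Q09 0 71 = true := by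
  decide +kernel

set_option maxRecDepth 16384 in
set_option maxHeartbeats 4000000 in
/-- Kernel residual band 1: rows [71, 107) of `s²Q − L̂D̂L̂ᵀ` are diagonally dominant. -/
theorem adv33it7DD09_1 : ddBand 1099511627776 adv33it7D09 adv33it7L09 adv33it7Q09 71 36 = true := by
  decide +kernel

set_option maxRecDepth 16384 in
set_option maxHeartbeats 4000000 in
/-- Kernel residual band 2: rows [107, 121) of `s²Q − L̂D̂L̂ᵀ` are diagonally dominant. -/
theorem adv33it7DD09_2 : ddBand 1099511627776 adv33it7D09 adv33it7L09 adv33it7Q09 107 14 = true := by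
  decide +kernel

end Summit.HubbardSuperconductivity.HubbardLadder.ClusterCut
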